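import Literature.MathematicalPhysics.QuantumLattice.SectorisedKernelNorm
import HarnessLib

/-!
# Re-sectorisation with a CORRELATED refinement count: the anchored sector sums of a leg-wise transformed kernel family when the
# number of admissible fine tuples refining a coarse tuple depends on the CLASS of the coarse tuple

Topic `MathematicalPhysics/QuantumLattice`; generic layer (label set `P × S`), companion of `SectorisedKernelNormRefinement` (uniform count
`R`: `‖W″‖_{A″} ≤ cr · c₁^m · R · ‖W‖_{univ}`).  Benfatto–Giuliani–Mastropietro 2006, (2.82)–(2.83) with (2.89): the sector sums of a vertex cost
one `L¹` overlap per leg times the number of fine sector tuples compatible with conservation refining the coarse tuple.  On a lattice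
(conservation modulo `2πℤ²`) that number is NOT uniform in the coarse tuple: at umklapp-corner configurations (all non-anchored coarse legs in
one direction pair, anchored fine leg transversal) it is larger by a factor `Λ` than BGM's `c^L γ^{(h−h′)(L−3)/2}` (cell gate-hubbard-kl,
p4 COUNTING-NOTE-2, Prop. N/P), and the repair proposed there is a CORRELATED count — carry the class of the coarse tuple into the parent's
sum.  This file is the bookkeeping slot for that: the data of `sectorLegSum_refine_le` with a class `B` of coarse tuples and two counts,
`R₁` off `B` and `R₂` on `B`:

* `sectorLegSum_refine_le_split` — `legSum_{A″}(W″; p, s″, x) ≤ cr · c₁^m · (R₁ · ‖W‖_{univ} + R₂ · ‖W‖_{B})`;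
* **`sectorisedKernelNorm_refine_le_split`** — the same for the norm.

The class enters only through the `B`-constrained norm `‖W‖_B` of the COARSE family, which a consumer bounds by (class sparsity through a
pinned leg) × (per-tuple pinned size) (`SectorisedKernelNormCount.sectorisedKernelNorm_le_card_mul`).  Everything is proved; no definition,
no named fact.

## Sources

G. Benfatto, A. Giuliani, V. Mastropietro, Ann. Henri Poincaré 7 (2006) 809–898, §2.7 (2.70)–(2.71a), §2.8 (2.82)–(2.83), (2.89), App. A3
[`BenfattoGiulianiMastropietro2006`].
-/

noncomputable section

namespace Literature.MathematicalPhysics.QuantumLattice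

open Finset

variable {𝕜 : Type*} [RCLike 𝕜] {S S'' P P'' : Type*} [Fintype S] [DecidableEq S] [DecidableEq S''] [Fintype P] [DecidableEq P]
  [Fintype P''] [DecidableEq P'']

/-- **Anchored sector sums under a child-supported leg-wise transform, SPLIT BY A CLASS OF COARSE TUPLES** (the slot for a
CORRELATED refinement count — BGM 2006 (2.82)–(2.83), (2.89) with a count that depends on the coarse configuration, e.g. the umklapp-corner
class of the lattice count): data as in `sectorLegSum_refine_le`, but the refinement count is bounded by `R₁` for coarse tuples OFF a class
`B` and by `R₂` ON it.  Then `legSum_{A″}(W″; p, s″, x) ≤ cr · c₁^m · (R₁ · ‖W‖_{univ} + R₂ · ‖W‖_{B})` — the class enters only through the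
`B`-constrained norm of the coarse family (which a consumer bounds by (class sparsity) × (per-tuple size), `sectorisedKernelNorm_le_card_mul`).
[cite: BenfattoGiulianiMastropietro2006, §2.8 (2.82)-(2.83) and (2.89)] -/
theorem sectorLegSum_refine_le_split {ε : ℝ} (hε : 0 ≤ ε) {m : ℕ} (T : P'' × S'' → P × S → 𝕜) (child : S'' → S → Prop)
    [DecidableRel child] (hT0 : ∀ x'' s'' x' s', ¬ child s'' s' → T (x'', s'') (x', s') = 0)
    {c₁ cr R₁ R₂ : ℝ} (hc₁ : 0 ≤ c₁) (hR₁ : 0 ≤ R₁) (hR₂ : 0 ≤ R₂)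
    (h1 : ∀ (s'' : S'') (x' : P) (s' : S), ∑ x'' : P'', ‖T (x'', s'') (x', s')‖ ≤ c₁)
    (h2 : ∀ X'' : P'' × S'', ∑ X' : P × S, ‖T X'' X'‖ ≤ cr)
    (A'' : Finset (Fin (m + 1) → S'')) (B : Finset (Fin (m + 1) → S))
    (hRoff : ∀ (σ' : Fin (m + 1) → S), σ' ∉ B → ∀ (p : Fin (m + 1)) (s'' : S''),
      (((A''.filter fun σ'' => σ'' p = s'' ∧ ∀ i, child (σ'' i) (σ' i)).card : ℝ)) ≤ R₁)
    (hRon : ∀ (σ' : Fin (m + 1) → S), σ' ∈ B → ∀ (p : Fin (m + 1)) (s'' : S''),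
      (((A''.filter fun σ'' => σ'' p = s'' ∧ ∀ i, child (σ'' i) (σ' i)).card : ℝ)) ≤ R₂)
    (W : (Fin (m + 1) → S) → (Fin (m + 1) → P) → 𝕜) (p : Fin (m + 1)) (s'' : S'') (x : P'') :
    sectorLegSum ε A''
        (fun σ'' x'' => ∑ σ' : Fin (m + 1) → S, ∑ x' : Fin (m + 1) → P, (∏ i, T (x'' i, σ'' i) (x' i, σ' i)) * W σ' x')
        p s'' x ≤
      cr * c₁ ^ m * (R₁ * sectorisedKernelNorm ε (m + 1) (univ : Finset (Fin (m + 1) → S)) W +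
        R₂ * sectorisedKernelNorm ε (m + 1) B W) := by
  set nW : ℝ := sectorisedKernelNorm ε (m + 1) (univ : Finset (Fin (m + 1) → S)) W with hnW
  set nB : ℝ := sectorisedKernelNorm ε (m + 1) B W with hnB
  have hnW0 : 0 ≤ nW := sectorisedKernelNorm_nonneg hε _ _ _
  have hnB0 : 0 ≤ nB := sectorisedKernelNorm_nonneg hε _ _ _
  -- abbreviation for the absolute transform entries
  set a : Fin (m + 1) → P'' → S'' → P → S → ℝ := fun _ x'' s'' x' s' => ‖T (x'', s'') (x', s')‖ with ha
  have ha0 : ∀ i x'' s'' x' s', 0 ≤ a i x'' s'' x' s' := fun _ _ _ _ _ => norm_nonneg _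
  -- Step 1: triangle inequality and reordering of the sums
  have step1 : sectorLegSum ε A''
        (fun σ'' x'' => ∑ σ' : Fin (m + 1) → S, ∑ x' : Fin (m + 1) → P, (∏ i, T (x'' i, σ'' i) (x' i, σ' i)) * W σ' x') p s'' x ≤
      ∑ σ' : Fin (m + 1) → S, ∑ x' : Fin (m + 1) → P, ‖W σ' x'‖ *
        (ε ^ m * ∑ σ'' ∈ A''.filter (fun σ'' => σ'' p = s''),
          ∑ x'' ∈ univ.filter (fun x'' : Fin (m + 1) → P'' => x'' p = x), ∏ i, a i (x'' i) (σ'' i) (x' i) (σ' i)) := by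
    rw [sectorLegSum]
    calc ∑ σ'' ∈ A''.filter (fun σ'' => σ'' p = s''), ε ^ m *
          ∑ x'' ∈ univ.filter (fun x'' : Fin (m + 1) → P'' => x'' p = x),
            ‖∑ σ' : Fin (m + 1) → S, ∑ x' : Fin (m + 1) → P, (∏ i, T (x'' i, σ'' i) (x' i, σ' i)) * W σ' x'‖
        ≤ ∑ σ'' ∈ A''.filter (fun σ'' => σ'' p = s''), ε ^ m *
          ∑ x'' ∈ univ.filter (fun x'' : Fin (m + 1) → P'' => x'' p = x),
            ∑ σ' : Fin (m + 1) → S, ∑ x' : Fin (m + 1) → P, (∏ i, a i (x'' i) (σ'' i) (x' i) (σ' i)) * ‖W σ' x'‖ := by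
          refine sum_le_sum fun σ'' _ => mul_le_mul_of_nonneg_left (sum_le_sum fun x'' _ => ?_) (pow_nonneg hε _)
          refine (norm_sum_le _ _).trans (sum_le_sum fun σ' _ => (norm_sum_le _ _).trans (sum_le_sum fun x' _ => ?_))
          rw [norm_mul, norm_prod]
      _ = _ := by
          -- pull `‖W σ' x'‖` to the front: reorder the four sums
          set Ap := A''.filter (fun σ'' => σ'' p = s'') with hAp
          set Xp := univ.filter (fun x'' : Fin (m + 1) → P'' => x'' p = x) with hXp
          calc ∑ σ'' ∈ Ap, ε ^ m * ∑ x'' ∈ Xp, ∑ σ' : Fin (m + 1) → S, ∑ x' : Fin (m + 1) → P,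
                (∏ i, a i (x'' i) (σ'' i) (x' i) (σ' i)) * ‖W σ' x'‖
              = ∑ σ'' ∈ Ap, ∑ x'' ∈ Xp, ∑ σ' : Fin (m + 1) → S, ∑ x' : Fin (m + 1) → P,
                  ε ^ m * ((∏ i, a i (x'' i) (σ'' i) (x' i) (σ' i)) * ‖W σ' x'‖) := by
                simp only [mul_sum]
            _ = ∑ σ'' ∈ Ap, ∑ σ' : Fin (m + 1) → S, ∑ x'' ∈ Xp, ∑ x' : Fin (m + 1) → P,
                  ε ^ m * ((∏ i, a i (x'' i) (σ'' i) (x' i) (σ' i)) * ‖W σ' x'‖) :=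
                sum_congr rfl fun σ'' _ => Finset.sum_comm
            _ = ∑ σ' : Fin (m + 1) → S, ∑ σ'' ∈ Ap, ∑ x'' ∈ Xp, ∑ x' : Fin (m + 1) → P,
                  ε ^ m * ((∏ i, a i (x'' i) (σ'' i) (x' i) (σ' i)) * ‖W σ' x'‖) := Finset.sum_comm
            _ = ∑ σ' : Fin (m + 1) → S, ∑ σ'' ∈ Ap, ∑ x' : Fin (m + 1) → P, ∑ x'' ∈ Xp,
                  ε ^ m * ((∏ i, a i (x'' i) (σ'' i) (x' i) (σ' i)) * ‖W σ' x'‖) :=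
                sum_congr rfl fun σ' _ => sum_congr rfl fun σ'' _ => Finset.sum_comm
            _ = ∑ σ' : Fin (m + 1) → S, ∑ x' : Fin (m + 1) → P, ∑ σ'' ∈ Ap, ∑ x'' ∈ Xp,
                  ε ^ m * ((∏ i, a i (x'' i) (σ'' i) (x' i) (σ' i)) * ‖W σ' x'‖) :=
                sum_congr rfl fun σ' _ => Finset.sum_comm
            _ = _ := by
                refine sum_congr rfl fun σ' _ => sum_congr rfl fun x' _ => ?_
                rw [mul_sum, mul_sum]
                refine sum_congr rfl fun σ'' _ => ?_
                rw [mul_sum, mul_sum]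
                exact sum_congr rfl fun x'' _ => by ring
  -- Step 2: the position sums factorise leg by leg; the pinned leg keeps its entry, the others cost `c₁` (or `0` off the children)
  have step2 : ∀ (σ'' : Fin (m + 1) → S'') (σ' : Fin (m + 1) → S) (x' : Fin (m + 1) → P), σ'' p = s'' →
      ∑ x'' ∈ univ.filter (fun x'' : Fin (m + 1) → P'' => x'' p = x), ∏ i, a i (x'' i) (σ'' i) (x' i) (σ' i) ≤
        a p x s'' (x' p) (σ' p) * (if ∀ i, child (σ'' i) (σ' i) then c₁ ^ m else 0) := by
    intro σ'' σ' x' hσp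
    -- the constrained position sum as a product of one-leg sums
    set t : Fin (m + 1) → Finset P'' := fun i => if i = p then {x} else univ with ht
    have hset : univ.filter (fun x'' : Fin (m + 1) → P'' => x'' p = x) = Fintype.piFinset t := by
      ext x''
      simp only [mem_filter, mem_univ, true_and, Fintype.mem_piFinset, ht]
      constructor
      · intro h i
        split_ifs with hi
        · subst hi; simp [h]
        · exact mem_univ _
      · intro h
        simpa using h p
    have hfac : ∑ x'' ∈ univ.filter (fun x'' : Fin (m + 1) → P'' => x'' p = x), ∏ i, a i (x'' i) (σ'' i) (x' i) (σ' i) =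
        a p x s'' (x' p) (σ' p) * ∏ i ∈ univ.erase p, ∑ j ∈ t i, a i j (σ'' i) (x' i) (σ' i) := by
      rw [hset, ← prod_univ_sum t (fun i j => a i j (σ'' i) (x' i) (σ' i)),
        ← Finset.mul_prod_erase univ (fun i => ∑ j ∈ t i, a i j (σ'' i) (x' i) (σ' i)) (mem_univ p)]
      congr 1
      simp only [ht, if_true, sum_singleton, hσp]
    rw [hfac]
    have hP0 : 0 ≤ ∏ i ∈ univ.erase p, ∑ j ∈ t i, a i j (σ'' i) (x' i) (σ' i) :=
      prod_nonneg fun i _ => sum_nonneg fun j _ => ha0 i j _ _ _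
    split_ifs with hch
    · -- every other leg: full position sum `≤ c₁`
      refine mul_le_mul_of_nonneg_left ?_ (ha0 p x s'' (x' p) (σ' p))
      have hcard : (univ.erase p).card = m := by rw [card_erase_of_mem (mem_univ p), card_univ, Fintype.card_fin]; omega
      calc ∏ i ∈ univ.erase p, ∑ j ∈ t i, a i j (σ'' i) (x' i) (σ' i) ≤ ∏ i ∈ univ.erase p, c₁ := by
            refine prod_le_prod (fun i _ => sum_nonneg fun j _ => ha0 i j _ _ _) fun i hi => ?_
            have hip : i ≠ p := ne_of_mem_erase hi
            simp only [ht, if_neg hip]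
            exact h1 _ _ _
        _ = c₁ ^ m := by rw [prod_const, hcard]
    · -- some leg is not a child: either the pinned entry or one of the other factors vanishes
      rw [mul_zero]
      push Not at hch
      obtain ⟨i, hi⟩ := hch
      by_cases hip : i = p
      · subst hip
        have hz : a i x s'' (x' i) (σ' i) = 0 := by
          simp only [ha]
          rw [hT0 _ _ _ _ (hσp ▸ hi), norm_zero]
        rw [hz, zero_mul]
      · refine le_of_eq ?_
        rw [prod_eq_zero (mem_erase.2 ⟨hip, mem_univ i⟩) ?_, mul_zero]
        simp only [ht, if_neg hip]
        exact sum_eq_zero fun j _ => by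
          simp only [ha]
          rw [hT0 _ _ _ _ hi, norm_zero]
  -- Step 3: the sector sum over the admissible fine tuples costs the refinement count, `R₁` off the class and `R₂` on it
  have step3 : ∀ (σ' : Fin (m + 1) → S) (x' : Fin (m + 1) → P),
      ∑ σ'' ∈ A''.filter (fun σ'' => σ'' p = s''),
          ∑ x'' ∈ univ.filter (fun x'' : Fin (m + 1) → P'' => x'' p = x), ∏ i, a i (x'' i) (σ'' i) (x' i) (σ' i) ≤
        a p x s'' (x' p) (σ' p) * (c₁ ^ m * (if σ' ∈ B then R₂ else R₁)) := by
    intro σ' x'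
    have hRσ : (((A''.filter fun σ'' => σ'' p = s'' ∧ ∀ i, child (σ'' i) (σ' i)).card : ℝ)) ≤ (if σ' ∈ B then R₂ else R₁) := by
      split_ifs with hB
      · exact hRon σ' hB p s''
      · exact hRoff σ' hB p s''
    calc ∑ σ'' ∈ A''.filter (fun σ'' => σ'' p = s''),
          ∑ x'' ∈ univ.filter (fun x'' : Fin (m + 1) → P'' => x'' p = x), ∏ i, a i (x'' i) (σ'' i) (x' i) (σ' i)
        ≤ ∑ σ'' ∈ A''.filter (fun σ'' => σ'' p = s''),
            a p x s'' (x' p) (σ' p) * (if ∀ i, child (σ'' i) (σ' i) then c₁ ^ m else 0) :=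
          sum_le_sum fun σ'' hσ'' => step2 σ'' σ' x' (mem_filter.1 hσ'').2
      _ = a p x s'' (x' p) (σ' p) * (c₁ ^ m *
            (((A''.filter fun σ'' => σ'' p = s'' ∧ ∀ i, child (σ'' i) (σ' i)).card : ℝ))) := by
          rw [← mul_sum, ← sum_filter, filter_filter, sum_const, nsmul_eq_mul]
          ring
      _ ≤ a p x s'' (x' p) (σ' p) * (c₁ ^ m * (if σ' ∈ B then R₂ else R₁)) :=
          mul_le_mul_of_nonneg_left (mul_le_mul_of_nonneg_left hRσ (pow_nonneg hc₁ _)) (ha0 p x s'' (x' p) (σ' p))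
  -- Step 5: for ANY constraint set `Bs` of coarse tuples, the `Bs`-restricted coarse sum, fiberwise over the pinned leg's coarse label, is `≤ cr · ‖W‖_{Bs}`
  have step5 : ∀ Bs : Finset (Fin (m + 1) → S),
      ∑ σ' ∈ Bs, ∑ x' : Fin (m + 1) → P, ‖W σ' x'‖ * (ε ^ m * a p x s'' (x' p) (σ' p)) ≤ cr * sectorisedKernelNorm ε (m + 1) Bs W := by
    intro Bs
    -- fiberwise over `(σ' p, x' p)`
    have hfib : ∑ σ' ∈ Bs, ∑ x' : Fin (m + 1) → P, ‖W σ' x'‖ * (ε ^ m * a p x s'' (x' p) (σ' p)) =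
        ∑ s' : S, ∑ y : P, a p x s'' y s' *
          (∑ σ' ∈ Bs.filter (fun σ' : Fin (m + 1) → S => σ' p = s'),
            ε ^ m * ∑ x' ∈ univ.filter (fun x' : Fin (m + 1) → P => x' p = y), ‖W σ' x'‖) := by
      calc ∑ σ' ∈ Bs, ∑ x' : Fin (m + 1) → P, ‖W σ' x'‖ * (ε ^ m * a p x s'' (x' p) (σ' p))
          = ∑ s' : S, ∑ σ' ∈ Bs.filter (fun σ' : Fin (m + 1) → S => σ' p = s'),
              ∑ y : P, ∑ x' ∈ univ.filter (fun x' : Fin (m + 1) → P => x' p = y), ‖W σ' x'‖ * (ε ^ m * a p x s'' y s') := by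
            rw [← Finset.sum_fiberwise Bs (fun σ' : Fin (m + 1) → S => σ' p) _]
            refine sum_congr rfl fun s' _ => sum_congr rfl fun σ' hσ' => ?_
            have hs' : σ' p = s' := (mem_filter.1 hσ').2
            rw [← Finset.sum_fiberwise univ (fun x' : Fin (m + 1) → P => x' p) _]
            refine sum_congr rfl fun y _ => sum_congr rfl fun x' hx' => ?_
            rw [(mem_filter.1 hx').2, hs']
        _ = ∑ s' : S, ∑ y : P, ∑ σ' ∈ Bs.filter (fun σ' : Fin (m + 1) → S => σ' p = s'),
              ∑ x' ∈ univ.filter (fun x' : Fin (m + 1) → P => x' p = y), ‖W σ' x'‖ * (ε ^ m * a p x s'' y s') :=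
            sum_congr rfl fun s' _ => Finset.sum_comm
        _ = _ := by
            refine sum_congr rfl fun s' _ => sum_congr rfl fun y _ => ?_
            rw [mul_sum]
            refine sum_congr rfl fun σ' _ => ?_
            rw [mul_sum, mul_sum]
            exact sum_congr rfl fun x' _ => by ring
    rw [hfib]
    have hn0 : 0 ≤ sectorisedKernelNorm ε (m + 1) Bs W := sectorisedKernelNorm_nonneg hε _ _ _
    -- each fibre sum is a leg sum of `W` over `Bs`, hence `≤ ‖W‖_{Bs}`
    have hrowT : ∑ s' : S, ∑ y : P, a p x s'' y s' = ∑ X' : P × S, ‖T (x, s'') X'‖ := by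
      rw [Fintype.sum_prod_type, Finset.sum_comm]
    calc ∑ s' : S, ∑ y : P, a p x s'' y s' *
          (∑ σ' ∈ Bs.filter (fun σ' : Fin (m + 1) → S => σ' p = s'),
            ε ^ m * ∑ x' ∈ univ.filter (fun x' : Fin (m + 1) → P => x' p = y), ‖W σ' x'‖)
        ≤ ∑ s' : S, ∑ y : P, a p x s'' y s' * sectorisedKernelNorm ε (m + 1) Bs W := by
          refine sum_le_sum fun s' _ => sum_le_sum fun y _ => mul_le_mul_of_nonneg_left ?_ (ha0 p x s'' y s')
          have h := sectorLegSum_le_sectorisedKernelNorm ε Bs W p s' y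
          rw [sectorLegSum] at h
          exact h
      _ = (∑ s' : S, ∑ y : P, a p x s'' y s') * sectorisedKernelNorm ε (m + 1) Bs W := by
          rw [Finset.sum_mul]
          exact sum_congr rfl fun s' _ => by rw [Finset.sum_mul]
      _ ≤ cr * sectorisedKernelNorm ε (m + 1) Bs W := by
          rw [hrowT]
          exact mul_le_mul_of_nonneg_right (h2 (x, s'')) hn0
  -- the split of the count, pointwise: `ite ≤ R₁ + R₂·[σ' ∈ B]` against the nonnegative weights
  have hsplit : ∀ (σ' : Fin (m + 1) → S) (x' : Fin (m + 1) → P),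
      ‖W σ' x'‖ * (ε ^ m * (a p x s'' (x' p) (σ' p) * (c₁ ^ m * (if σ' ∈ B then R₂ else R₁)))) ≤
        c₁ ^ m * R₁ * (‖W σ' x'‖ * (ε ^ m * a p x s'' (x' p) (σ' p))) +
          (if σ' ∈ B then c₁ ^ m * R₂ * (‖W σ' x'‖ * (ε ^ m * a p x s'' (x' p) (σ' p))) else 0) := by
    intro σ' x'
    have hq : 0 ≤ ‖W σ' x'‖ * (ε ^ m * a p x s'' (x' p) (σ' p)) :=
      mul_nonneg (norm_nonneg _) (mul_nonneg (pow_nonneg hε _) (ha0 p x s'' (x' p) (σ' p)))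
    have hc : 0 ≤ c₁ ^ m := pow_nonneg hc₁ _
    split_ifs with hB
    · have h0 : 0 ≤ c₁ ^ m * R₁ * (‖W σ' x'‖ * (ε ^ m * a p x s'' (x' p) (σ' p))) := by positivity
      calc ‖W σ' x'‖ * (ε ^ m * (a p x s'' (x' p) (σ' p) * (c₁ ^ m * R₂)))
          = c₁ ^ m * R₂ * (‖W σ' x'‖ * (ε ^ m * a p x s'' (x' p) (σ' p))) := by ring
        _ ≤ _ := le_add_of_nonneg_left h0
    · have h0 : 0 ≤ c₁ ^ m * R₂ * (‖W σ' x'‖ * (ε ^ m * a p x s'' (x' p) (σ' p))) := by positivity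
      calc ‖W σ' x'‖ * (ε ^ m * (a p x s'' (x' p) (σ' p) * (c₁ ^ m * R₁)))
          = c₁ ^ m * R₁ * (‖W σ' x'‖ * (ε ^ m * a p x s'' (x' p) (σ' p))) := by ring
        _ ≤ _ := le_add_of_nonneg_right le_rfl
  -- the two coarse sums
  have hsumU : ∑ σ' : Fin (m + 1) → S, ∑ x' : Fin (m + 1) → P,
      c₁ ^ m * R₁ * (‖W σ' x'‖ * (ε ^ m * a p x s'' (x' p) (σ' p))) ≤ c₁ ^ m * R₁ * (cr * nW) := by
    rw [← show c₁ ^ m * R₁ * ∑ σ' : Fin (m + 1) → S, ∑ x' : Fin (m + 1) → P,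
        ‖W σ' x'‖ * (ε ^ m * a p x s'' (x' p) (σ' p)) = ∑ σ' : Fin (m + 1) → S, ∑ x' : Fin (m + 1) → P,
        c₁ ^ m * R₁ * (‖W σ' x'‖ * (ε ^ m * a p x s'' (x' p) (σ' p))) by
      rw [mul_sum]; exact sum_congr rfl fun σ' _ => by rw [mul_sum]]
    refine mul_le_mul_of_nonneg_left ?_ (by positivity)
    have h := step5 univ
    simpa only [hnW] using h
  have hsumB : ∑ σ' : Fin (m + 1) → S, ∑ x' : Fin (m + 1) → P,
      (if σ' ∈ B then c₁ ^ m * R₂ * (‖W σ' x'‖ * (ε ^ m * a p x s'' (x' p) (σ' p))) else 0) ≤ c₁ ^ m * R₂ * (cr * nB) := by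
    have hre : ∑ σ' : Fin (m + 1) → S, ∑ x' : Fin (m + 1) → P,
        (if σ' ∈ B then c₁ ^ m * R₂ * (‖W σ' x'‖ * (ε ^ m * a p x s'' (x' p) (σ' p))) else 0) =
        c₁ ^ m * R₂ * ∑ σ' ∈ B, ∑ x' : Fin (m + 1) → P, ‖W σ' x'‖ * (ε ^ m * a p x s'' (x' p) (σ' p)) := by
      calc ∑ σ' : Fin (m + 1) → S, ∑ x' : Fin (m + 1) → P,
            (if σ' ∈ B then c₁ ^ m * R₂ * (‖W σ' x'‖ * (ε ^ m * a p x s'' (x' p) (σ' p))) else 0)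
          = ∑ σ' : Fin (m + 1) → S, (if σ' ∈ B then ∑ x' : Fin (m + 1) → P,
              c₁ ^ m * R₂ * (‖W σ' x'‖ * (ε ^ m * a p x s'' (x' p) (σ' p))) else 0) :=
            sum_congr rfl fun σ' _ => by split_ifs <;> simp
        _ = ∑ σ' ∈ B, ∑ x' : Fin (m + 1) → P, c₁ ^ m * R₂ * (‖W σ' x'‖ * (ε ^ m * a p x s'' (x' p) (σ' p))) := by
            rw [← sum_filter]
            congr 1
            ext σ'
            simp
        _ = _ := by rw [mul_sum]; exact sum_congr rfl fun σ' _ => by rw [mul_sum]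
    rw [hre]
    refine mul_le_mul_of_nonneg_left ?_ (by positivity)
    have h := step5 B
    simpa only [hnB] using h
  -- assemble
  calc sectorLegSum ε A''
        (fun σ'' x'' => ∑ σ' : Fin (m + 1) → S, ∑ x' : Fin (m + 1) → P, (∏ i, T (x'' i, σ'' i) (x' i, σ' i)) * W σ' x') p s'' x
      ≤ ∑ σ' : Fin (m + 1) → S, ∑ x' : Fin (m + 1) → P, ‖W σ' x'‖ *
          (ε ^ m * ∑ σ'' ∈ A''.filter (fun σ'' => σ'' p = s''),
            ∑ x'' ∈ univ.filter (fun x'' : Fin (m + 1) → P'' => x'' p = x), ∏ i, a i (x'' i) (σ'' i) (x' i) (σ' i)) := step1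
    _ ≤ ∑ σ' : Fin (m + 1) → S, ∑ x' : Fin (m + 1) → P,
          ‖W σ' x'‖ * (ε ^ m * (a p x s'' (x' p) (σ' p) * (c₁ ^ m * (if σ' ∈ B then R₂ else R₁)))) :=
        sum_le_sum fun σ' _ => sum_le_sum fun x' _ =>
          mul_le_mul_of_nonneg_left (mul_le_mul_of_nonneg_left (step3 σ' x') (pow_nonneg hε _)) (norm_nonneg _)
    _ ≤ ∑ σ' : Fin (m + 1) → S, ∑ x' : Fin (m + 1) → P,
          (c₁ ^ m * R₁ * (‖W σ' x'‖ * (ε ^ m * a p x s'' (x' p) (σ' p))) +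
            (if σ' ∈ B then c₁ ^ m * R₂ * (‖W σ' x'‖ * (ε ^ m * a p x s'' (x' p) (σ' p))) else 0)) :=
        sum_le_sum fun σ' _ => sum_le_sum fun x' _ => hsplit σ' x'
    _ = (∑ σ' : Fin (m + 1) → S, ∑ x' : Fin (m + 1) → P,
            c₁ ^ m * R₁ * (‖W σ' x'‖ * (ε ^ m * a p x s'' (x' p) (σ' p)))) +
          ∑ σ' : Fin (m + 1) → S, ∑ x' : Fin (m + 1) → P,
            (if σ' ∈ B then c₁ ^ m * R₂ * (‖W σ' x'‖ * (ε ^ m * a p x s'' (x' p) (σ' p))) else 0) := by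
        rw [← sum_add_distrib]
        exact sum_congr rfl fun σ' _ => sum_add_distrib
    _ ≤ c₁ ^ m * R₁ * (cr * nW) + c₁ ^ m * R₂ * (cr * nB) := add_le_add hsumU hsumB
    _ = cr * c₁ ^ m * (R₁ * nW + R₂ * nB) := by ring

/-- **The sectorised norm under a child-supported leg-wise transform, split by a class of coarse tuples**: with the data of
`sectorLegSum_refine_le_split`, `‖W″‖_{A″} ≤ cr · c₁^m · (R₁ · ‖W‖_{univ} + R₂ · ‖W‖_{B})`.
[cite: BenfattoGiulianiMastropietro2006, §2.8 (2.82)-(2.83) and (2.89)] -/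
theorem sectorisedKernelNorm_refine_le_split [Finite S''] {ε : ℝ} (hε : 0 ≤ ε) {m : ℕ} (T : P'' × S'' → P × S → 𝕜)
    (child : S'' → S → Prop) [DecidableRel child] (hT0 : ∀ x'' s'' x' s', ¬ child s'' s' → T (x'', s'') (x', s') = 0)
    {c₁ cr R₁ R₂ : ℝ} (hc₁ : 0 ≤ c₁) (hcr : 0 ≤ cr) (hR₁ : 0 ≤ R₁) (hR₂ : 0 ≤ R₂)
    (h1 : ∀ (s'' : S'') (x' : P) (s' : S), ∑ x'' : P'', ‖T (x'', s'') (x', s')‖ ≤ c₁)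
    (h2 : ∀ X'' : P'' × S'', ∑ X' : P × S, ‖T X'' X'‖ ≤ cr)
    (A'' : Finset (Fin (m + 1) → S'')) (B : Finset (Fin (m + 1) → S))
    (hRoff : ∀ (σ' : Fin (m + 1) → S), σ' ∉ B → ∀ (p : Fin (m + 1)) (s'' : S''),
      (((A''.filter fun σ'' => σ'' p = s'' ∧ ∀ i, child (σ'' i) (σ' i)).card : ℝ)) ≤ R₁)
    (hRon : ∀ (σ' : Fin (m + 1) → S), σ' ∈ B → ∀ (p : Fin (m + 1)) (s'' : S''),
      (((A''.filter fun σ'' => σ'' p = s'' ∧ ∀ i, child (σ'' i) (σ' i)).card : ℝ)) ≤ R₂)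
    (W : (Fin (m + 1) → S) → (Fin (m + 1) → P) → 𝕜) :
    sectorisedKernelNorm ε (m + 1) A''
        (fun σ'' x'' => ∑ σ' : Fin (m + 1) → S, ∑ x' : Fin (m + 1) → P, (∏ i, T (x'' i, σ'' i) (x' i, σ' i)) * W σ' x') ≤
      cr * c₁ ^ m * (R₁ * sectorisedKernelNorm ε (m + 1) (univ : Finset (Fin (m + 1) → S)) W +
        R₂ * sectorisedKernelNorm ε (m + 1) B W) :=
  sectorisedKernelNorm_le_of_forall_le
    (mul_nonneg (by positivity) (add_nonneg (mul_nonneg hR₁ (sectorisedKernelNorm_nonneg hε _ _ _))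
      (mul_nonneg hR₂ (sectorisedKernelNorm_nonneg hε _ _ _)))) fun p s'' x =>
    sectorLegSum_refine_le_split hε T child hT0 hc₁ hR₁ hR₂ h1 h2 A'' B hRoff hRon W p s'' x

end Literature.MathematicalPhysics.QuantumLattice

end
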